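/-
Copyright (c) 2026. All rights reserved.
Released under Apache 2.0 license as described in the file LICENSE.
-/
import Summits.ValiantsHypothesis.ValiantsHypothesis.Theorems.TopDegreeDoor
import Summits.ValiantsHypothesis.ValiantsHypothesis.Theorems.ReadOnceCFIsolation
import HarnessLib

/-!
# Read-once affine determinants with a variable transversal are hit by the VNP column

Stage O-L2-18 (FILE 2 of 2) of the W4 isolation road, lens 2 «natural-proofs / succinctness axis»
([cite: ForbesShpilkaVolk2018, §8] dictionary; [cite: FennerGurjarThierauf2016, Theorem 3.1]
weights). Rung 1 (`ReadOnceCFIsolation.readOnceCFDets_hit`) needs every constant entry to be `0`;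
here the constants are ARBITRARY, provided some permutation lies on variable positions
(equivalently `deg D = r`).

* §5 THE CONSTANT-FREE SHADOW `cfShadow E` (constants ↦ `0`) and the Leibniz degree split: a term
  through a constant has degree `< r`, an all-variable term is homogeneous of degree `r` and equals
  the shadow's, so `homogeneousComponent r (det E) = det (cfShadow E)` for ANY constants
  (`homogeneousComponent_det`); with a read-once template and a variable transversal `deg = r`
  (`totalDegree_det_eq`, lower bound by `ReadOnceCFSupport.monoOf_mem_support` BY NAME).
* §6 THE FAMILY `readOnceTDets` (item 20152's clause + a variable transversal), its top components
  lie in `readOnceCFDets` (`top_image_subset`), so g40's `smallIsolatingWeights_readOnceCF` BY NAME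
  min-isolates them, and the top-degree door `TopDegreeDoor.topDegreeDoor` BY NAME gives the
  HEADLINE `readOnceTDets_hit`; `mem_readOnceTDets_of_cf`: rung 1 ⊆ rung 1′ on nonzero members.
Currency: kernel-certified rung 1′ on the W4 ladder (VNP column); closes no item; TWO data defs
(`cfShadow`, `readOnceTDets`), no facts, no `Prop` definitions, no doors of its own.
-/

noncomputable section

open MvPolynomial Finset

set_option linter.dupNamespace false

namespace Summit.ValiantsHypothesis.ValiantsHypothesis.Theorems.ReadOnceTransversalIsolation

open Literature.Barriers.ValiantsHypothesis Literature.Computability.AlgebraicComplexity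
  Literature.Computability.Complexity CircuitArith BoolGadgets SuccinctTables RoundCircuits
  ReadOnceCFSupport ReadOnceCFIsolation TopDegreeDoor

/-! ### §5 The constant-free shadow of an affine template and its top component -/

section Template

variable {F : Type*} [Field F] {M : Type*} {r : ℕ}

/-- The constant-free shadow: every constant entry replaced by `0` (construction datum). [folklore] -/
def cfShadow (E : Matrix (Fin r) (Fin r) (M ⊕ F)) : Matrix (Fin r) (Fin r) (M ⊕ F) :=
  E.map (Sum.map id fun _ => (0 : F))

/-- Entries of the shadow. [this file] -/
theorem cfShadow_apply (E : Matrix (Fin r) (Fin r) (M ⊕ F)) (i j : Fin r) :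
    cfShadow E i j = Sum.map id (fun _ => (0 : F)) (E i j) := rfl

/-- The shadow keeps the variable positions. [this file] -/
theorem isLeft_cfShadow (E : Matrix (Fin r) (Fin r) (M ⊕ F)) (i j : Fin r) :
    (cfShadow E i j).isLeft = (E i j).isLeft := by
  rw [cfShadow_apply]; cases E i j <;> simp

/-- The shadow keeps the variable entries. [this file] -/
theorem cfShadow_eq_inl_iff (E : Matrix (Fin r) (Fin r) (M ⊕ F)) {i j : Fin r} {m : M} :
    cfShadow E i j = Sum.inl m ↔ E i j = Sum.inl m := by
  rw [cfShadow_apply]; cases E i j <;> simp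

/-- The shadow of a read-once template is read-once. [this file] -/
theorem cfShadow_readOnce (E : Matrix (Fin r) (Fin r) (M ⊕ F))
    (hro : ∀ p q : Fin r × Fin r, ∀ m, E p.1 p.2 = Sum.inl m → E q.1 q.2 = Sum.inl m → p = q) :
    ∀ p q : Fin r × Fin r, ∀ m, cfShadow E p.1 p.2 = Sum.inl m → cfShadow E q.1 q.2 = Sum.inl m →
      p = q :=
  fun p q m hp hq => hro p q m ((cfShadow_eq_inl_iff E).1 hp) ((cfShadow_eq_inl_iff E).1 hq)

/-- The shadow is constant-free. [this file] -/
theorem cfShadow_cf (E : Matrix (Fin r) (Fin r) (M ⊕ F)) :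
    ∀ (i j : Fin r) (c : F), cfShadow E i j = Sum.inr c → c = 0 := by
  intro i j c h
  rw [cfShadow_apply] at h
  revert h
  cases E i j with
  | inl m => simp
  | inr c' => simp only [Sum.map_inr, Sum.inr.injEq]; exact fun h => h.symm

/-- Leibniz term on variable positions only: homogeneous of degree `r`, and equal to the shadow's.
[folklore] -/
theorem prod_entry_of_isLeft (E : Matrix (Fin r) (Fin r) (M ⊕ F)) {σ : Equiv.Perm (Fin r)}
    (hσ : ∀ k, (E (σ k) k).isLeft = true) :
    (∏ k, Sum.elim MvPolynomial.X MvPolynomial.C (E (σ k) k) : MvPolynomial M F).IsHomogeneous r ∧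
    (∏ k, Sum.elim MvPolynomial.X MvPolynomial.C (E (σ k) k) : MvPolynomial M F) =
      ∏ k, Sum.elim MvPolynomial.X MvPolynomial.C (cfShadow E (σ k) k) := by
  have hv : ∀ k, ∃ m, E (σ k) k = Sum.inl m := fun k => Sum.isLeft_iff.1 (hσ k)
  choose v hv using hv
  have h1 : ∀ k, (Sum.elim MvPolynomial.X MvPolynomial.C (E (σ k) k) : MvPolynomial M F) =
      X (v k) := fun k => by simp only [hv k, Sum.elim_inl]
  have h2 : ∀ k, (Sum.elim MvPolynomial.X MvPolynomial.C (cfShadow E (σ k) k) : MvPolynomial M F) =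
      X (v k) := fun k => by simp only [cfShadow_apply, hv k, Sum.map_inl, id_eq, Sum.elim_inl]
  have heq : (∏ k, Sum.elim MvPolynomial.X MvPolynomial.C (E (σ k) k) : MvPolynomial M F) =
      ∏ k, X (v k) := Finset.prod_congr rfl fun k _ => h1 k
  have heq' : (∏ k, Sum.elim MvPolynomial.X MvPolynomial.C (cfShadow E (σ k) k) : MvPolynomial M F)
      = ∏ k, X (v k) := Finset.prod_congr rfl fun k _ => h2 k
  refine ⟨?_, heq.trans heq'.symm⟩
  rw [heq]
  have := IsHomogeneous.prod Finset.univ (fun k => (X (v k) : MvPolynomial M F)) (fun _ => 1)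
    fun k _ => isHomogeneous_X F (v k)
  simpa using this

/-- Leibniz term through a constant entry: total degree `< r`. [folklore] -/
theorem totalDegree_prod_entry_lt (E : Matrix (Fin r) (Fin r) (M ⊕ F)) {σ : Equiv.Perm (Fin r)}
    (hσ : ¬ ∀ k, (E (σ k) k).isLeft = true) :
    (∏ k, Sum.elim MvPolynomial.X MvPolynomial.C (E (σ k) k) : MvPolynomial M F).totalDegree < r := by
  obtain ⟨k₀, hk₀⟩ := not_forall.1 hσ
  have hle : ∀ k, (Sum.elim MvPolynomial.X MvPolynomial.C (E (σ k) k) : MvPolynomial M F).totalDegree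
      ≤ 1 := fun k => by
    cases E (σ k) k with
    | inl m => exact (isHomogeneous_X F m).totalDegree_le
    | inr c => exact (totalDegree_C c).trans_le (Nat.zero_le 1)
  have h0 : (Sum.elim MvPolynomial.X MvPolynomial.C (E (σ k₀) k₀) : MvPolynomial M F).totalDegree
      = 0 := by
    revert hk₀
    cases E (σ k₀) k₀ with
    | inl m => simp
    | inr c => exact fun _ => totalDegree_C c
  calc (∏ k, Sum.elim MvPolynomial.X MvPolynomial.C (E (σ k) k) : MvPolynomial M F).totalDegree
      ≤ ∑ k, (Sum.elim MvPolynomial.X MvPolynomial.C (E (σ k) k) : MvPolynomial M F).totalDegree :=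
        totalDegree_finsetProd _ _
    _ = (Sum.elim MvPolynomial.X MvPolynomial.C (E (σ k₀) k₀) : MvPolynomial M F).totalDegree +
          ∑ k ∈ univ.erase k₀,
            (Sum.elim MvPolynomial.X MvPolynomial.C (E (σ k) k) : MvPolynomial M F).totalDegree :=
        (Finset.add_sum_erase _ _ (mem_univ k₀)).symm
    _ ≤ 0 + ∑ k ∈ univ.erase k₀, 1 := by
        rw [h0]; exact Nat.add_le_add_left (Finset.sum_le_sum fun k _ => hle k) 0
    _ = r - 1 := by
        rw [zero_add, Finset.sum_const, smul_eq_mul, mul_one, Finset.card_erase_of_mem (mem_univ _),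
          Finset.card_univ, Fintype.card_fin]
    _ < r := Nat.sub_lt k₀.pos Nat.one_pos

/-- An affine template determinant has total degree `≤ r`. [folklore] -/
theorem totalDegree_det_le (E : Matrix (Fin r) (Fin r) (M ⊕ F)) :
    (E.map (Sum.elim MvPolynomial.X MvPolynomial.C)).det.totalDegree ≤ r := by
  rw [Matrix.det_apply']
  refine (totalDegree_finsetSum _ _).trans (Finset.sup_le fun σ _ => ?_)
  refine (totalDegree_mul _ _).trans ?_
  have hC : ((Equiv.Perm.sign σ : ℤ) : MvPolynomial M F) = C ((Equiv.Perm.sign σ : ℤ) : F) :=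
    (map_intCast (C : F →+* MvPolynomial M F) _).symm
  rw [hC, totalDegree_C, zero_add]
  simp only [Matrix.map_apply]
  by_cases hσ : ∀ k, (E (σ k) k).isLeft = true
  · exact (prod_entry_of_isLeft E hσ).1.totalDegree_le
  · exact (totalDegree_prod_entry_lt E hσ).le

/-- **The degree-`r` component of an affine template determinant is the determinant of its
constant-free shadow** (all cancellation caused by constants lives in degree `< r`). [folklore] -/
theorem homogeneousComponent_det (E : Matrix (Fin r) (Fin r) (M ⊕ F)) :
    homogeneousComponent r (E.map (Sum.elim MvPolynomial.X MvPolynomial.C)).det =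
      ((cfShadow E).map (Sum.elim MvPolynomial.X MvPolynomial.C)).det := by
  rw [Matrix.det_apply', Matrix.det_apply', map_sum]
  refine Finset.sum_congr rfl fun σ _ => ?_
  have hC : ((Equiv.Perm.sign σ : ℤ) : MvPolynomial M F) = C ((Equiv.Perm.sign σ : ℤ) : F) :=
    (map_intCast (C : F →+* MvPolynomial M F) _).symm
  rw [hC, homogeneousComponent_C_mul]
  simp only [Matrix.map_apply]
  by_cases hσ : ∀ k, (E (σ k) k).isLeft = true
  · obtain ⟨hhom, heq⟩ := prod_entry_of_isLeft E hσ
    rw [homogeneousComponent_eq_self hhom, heq]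
  · have hσ' : ¬ ∀ k, varRel (cfShadow E) k (σ k) := by
      simpa [varRel, isLeft_cfShadow] using hσ
    rw [homogeneousComponent_eq_zero _ _ (totalDegree_prod_entry_lt E hσ),
      prod_entry_of_not_adm (cfShadow E) (cfShadow_cf E) hσ', mul_zero]

/-- With a read-once template and a VARIABLE TRANSVERSAL the degree is exactly `r`. [folklore] -/
theorem totalDegree_det_eq (μ₀ : M) (E : Matrix (Fin r) (Fin r) (M ⊕ F))
    (hro : ∀ p q : Fin r × Fin r, ∀ m, E p.1 p.2 = Sum.inl m → E q.1 q.2 = Sum.inl m → p = q)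
    {σ₀ : Equiv.Perm (Fin r)} (hσ₀ : ∀ k, (E (σ₀ k) k).isLeft = true) :
    (E.map (Sum.elim MvPolynomial.X MvPolynomial.C)).det.totalDegree = r := by
  classical
  refine le_antisymm (totalDegree_det_le E) ?_
  have hσ₀' : ∀ k, varRel (cfShadow E) k (σ₀ k) := fun k => by
    show (cfShadow E (σ₀ k) k).isLeft = true
    rw [isLeft_cfShadow]; exact hσ₀ k
  have hmem := monoOf_mem_support μ₀ (cfShadow E) (cfShadow_readOnce E hro) (cfShadow_cf E) hσ₀'
  rw [← homogeneousComponent_det E, support_homogeneousComponent, Finset.mem_filter] at hmem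
  calc r = (monoOf (varLab μ₀ (cfShadow E)) σ₀).degree := hmem.2.symm
    _ = (monoOf (varLab μ₀ (cfShadow E)) σ₀).sum (fun _ e => e) := degree_eq_sum_id _
    _ ≤ _ := le_totalDegree hmem.1

/-- Hence its TOP component is the shadow determinant. [folklore] -/
theorem top_det_eq (μ₀ : M) (E : Matrix (Fin r) (Fin r) (M ⊕ F))
    (hro : ∀ p q : Fin r × Fin r, ∀ m, E p.1 p.2 = Sum.inl m → E q.1 q.2 = Sum.inl m → p = q)
    {σ₀ : Equiv.Perm (Fin r)} (hσ₀ : ∀ k, (E (σ₀ k) k).isLeft = true) :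
    homogeneousComponent (E.map (Sum.elim MvPolynomial.X MvPolynomial.C)).det.totalDegree
        (E.map (Sum.elim MvPolynomial.X MvPolynomial.C)).det =
      ((cfShadow E).map (Sum.elim MvPolynomial.X MvPolynomial.C)).det := by
  rw [totalDegree_det_eq μ₀ E hro hσ₀]
  exact homogeneousComponent_det E

end Template

/-! ### §6 The family and the headline -/

section Main

variable (F : Type*) [Field F]

/-- READ-ONCE AFFINE DETERMINANTS WITH A VARIABLE TRANSVERSAL (constants ARBITRARY), of size
`r ≤ binom(2n,n)^a` in the coefficient variables: the family of item 20152
(`Theses/BarrierLever.lean` l.1335, `ReadOnceDeterminantsHitByVP : ∀ a, ∃ b n₀, ∀ n ≥ n₀,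
IsSuccinctHittingSet (degLEMonomials n) (SmallCircuits ℂ n b) {D | ∃ r E, r ≤ binom(2n,n)^a ∧
read-once ∧ D = (E.map (Sum.elim X C)).det}`) cut out by ONE extra clause — some permutation lies
on variable positions (equivalently `deg D = r`) — and it is hit here in the VNP column
(`SmallDefinable`, not `SmallCircuits`) over every infinite field of characteristic `0` (not only
`ℂ`). Contains every nonzero member of rung 1's `readOnceCFDets` (`mem_readOnceTDets_of_cf`).
[cite: ForbesShpilkaVolk2018, §8] -/
def readOnceTDets (n a : ℕ) : Set (MvPolynomial (degLEMonomials n) F) :=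
  {D | ∃ (r : ℕ) (E : Matrix (Fin r) (Fin r) (degLEMonomials n ⊕ F)),
    r ≤ (Nat.choose (2 * n) n) ^ a ∧
    (∀ p q : Fin r × Fin r, ∀ m, E p.1 p.2 = Sum.inl m → E q.1 q.2 = Sum.inl m → p = q) ∧
    (∃ σ : Equiv.Perm (Fin r), ∀ k, (E (σ k) k).isLeft = true) ∧
    D = (E.map (Sum.elim MvPolynomial.X MvPolynomial.C)).det}

/-- Top components of the family are constant-free read-once determinants. [this file] -/
theorem top_image_subset (n a : ℕ) :
    (fun D : MvPolynomial (degLEMonomials n) F => homogeneousComponent D.totalDegree D) ''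
        readOnceTDets F n a ⊆ readOnceCFDets F n a := by
  rintro _ ⟨D, ⟨r, E, hr, hro, ⟨σ₀, hσ₀⟩, rfl⟩, rfl⟩
  exact ⟨r, cfShadow E, hr, cfShadow_readOnce E hro, cfShadow_cf E,
    top_det_eq ⟨0, by simp [degLEMonomials]⟩ E hro hσ₀⟩

/-- `SmallIsolatingWeights` is monotone in the family. [this file] -/
theorem smallIsolatingWeights_mono {𝒟 𝒟' : (n : ℕ) → Set (MvPolynomial (degLEMonomials n) F)}
    (h : ∀ n, 𝒟' n ⊆ 𝒟 n) {c : ℕ} (hc : SmallIsolatingWeights F 𝒟 c) :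
    SmallIsolatingWeights F 𝒟' c := by
  obtain ⟨n₁, H⟩ := hc
  exact ⟨n₁, fun n hn D hD hD0 => H n hn D (h n hD) hD0⟩

/-- Small-circuit min-isolating weights for the TOP components, from g40's
`smallIsolatingWeights_readOnceCF` BY NAME. [cite: FennerGurjarThierauf2016, Theorem 3.1] -/
theorem smallIsolatingWeights_top (a : ℕ) : ∃ c : ℕ, SmallIsolatingWeights F
    (fun n => (fun D : MvPolynomial (degLEMonomials n) F =>
      homogeneousComponent D.totalDegree D) '' readOnceTDets F n a) c := by
  obtain ⟨c, hc⟩ := smallIsolatingWeights_readOnceCF F a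
  exact ⟨c, smallIsolatingWeights_mono F (fun n => top_image_subset F n a) hc⟩

/-- Degree bound `deg D ≤ r ≤ binom(2n,n)^a ≤ 2^(2na) ≤ 2^(n^(a+2))` for `n ≥ 2`. [this file] -/
theorem totalDegree_bound (a : ℕ) : ∃ n₂ : ℕ, ∀ n : ℕ, n₂ ≤ n →
    ∀ D ∈ readOnceTDets F n a, D.totalDegree ≤ 2 ^ n ^ (a + 2) := by
  refine ⟨2, fun n hn D hD => ?_⟩
  obtain ⟨r, E, hr, hro, ⟨σ₀, hσ₀⟩, rfl⟩ := hD
  have ha : a ≤ n ^ a := Nat.lt_two_pow_self.le.trans (Nat.pow_le_pow_left hn a)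
  have h2n : 2 * n ≤ n ^ 2 := by rw [sq]; exact Nat.mul_le_mul_right n hn
  have h2 : 2 * n * a ≤ n ^ (a + 2) := by
    rw [pow_add, mul_comm (n ^ a)]; exact Nat.mul_le_mul h2n ha
  exact (totalDegree_det_le E).trans
    ((le_two_pow_of_le hr).trans (Nat.pow_le_pow_right (by norm_num) h2))

/-- **HEADLINE (W4, VNP column, rung 1′): read-once affine determinants with a variable
transversal — constants arbitrary — are hit by `SmallDefinable`**, by the top-degree door
`topDegreeDoor` BY NAME (top components = shadows, min-isolated by
`smallIsolatingWeights_readOnceCF`; degree `≤ 2^(n^(a+2))`). [cite: ForbesShpilkaVolk2018, §8] -/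
theorem readOnceTDets_hit [CharZero F] [Infinite F] (a : ℕ) :
    ∃ b n₀ : ℕ, ∀ n : ℕ, n₀ ≤ n →
      IsSuccinctHittingSet (degLEMonomials n) (SmallDefinable F n b) (readOnceTDets F n a) := by
  obtain ⟨c, hc⟩ := smallIsolatingWeights_top F a
  exact topDegreeDoor F (fun n => readOnceTDets F n a) hc (totalDegree_bound F a)

/-- Rung 1 ⊆ rung 1′ on nonzero members: a nonzero constant-free read-once determinant has a
variable transversal (`exists_perm_of_det_ne_zero` BY NAME). [this file] -/
theorem mem_readOnceTDets_of_cf {n a : ℕ} {D : MvPolynomial (degLEMonomials n) F}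
    (hD : D ∈ readOnceCFDets F n a) (hD0 : D ≠ 0) : D ∈ readOnceTDets F n a := by
  obtain ⟨r, E, hr, hro, hcf, rfl⟩ := hD
  obtain ⟨σ, hσ⟩ := exists_perm_of_det_ne_zero E hcf hD0
  exact ⟨r, E, hr, hro, ⟨σ, fun k => hσ k⟩, rfl⟩

end Main

end Summit.ValiantsHypothesis.ValiantsHypothesis.Theorems.ReadOnceTransversalIsolation

end
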